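import Literature.MathematicalPhysics.QuantumFieldTheory.CurvatureGaussianField
import Literature.Probability.LatticeModels.LatticeGreenGradient
import Literature.Probability.LatticeModels.LatticeGreenPositive
import Literature.Probability.LatticeModels.VillainSpinWaveCorollaries
import Literature.Probability.LatticeModels.LatticeGreenOriginBound
import HarnessLib

/-!
# Block Green one-form of a plaquette, III: decay on `ℤ⁴` and box geometry (support file of stub `stub_blockGreen`)

Route `SteinGapBootstrap` of `YangMills`, crux U = `Theses.SteinGapBootstrap.FreeProbeLawG`
(stmt-QuantumFields-23756), line `birth` (RESHAPE 2, lead `ym-line-sgb-k1`), registered stub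
`stub_blockGreen`. The ANALYTIC input, in `d = 4`:

* `exists_half_latticeGreen_diff_le` — first differences of the Green function `G₀ = latticeGreen / 2` of `-Δ`
  on `ℤ⁴` decay like `|z|⁻³`: `|G₀(z + eᵢ) - G₀(z)| ≤ C₂ / (1 + |z|)³` for ALL `z` (Lawler 1991 Thm 1.5.5 via the
  tree's `latticeGreen_gradient_bound` for `z ≠ 0`; `0 < G ≤ G(0) ≤ 1/2` at `z = 0`);
* `exists_greenForm_le` — hence the Green one-form of a plaquette, `ω_p(y, k) = ∑ₐ σₐ edgeGreen (∂ₐ p) (y, k)`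
  (a first difference of `G₀(x_p - ·)` in the direction of the other side of `p`, or `0`), satisfies
  `|ω_p(y, k)| ≤ C₁ / (1 + |x_p - y|)³`;
* box geometry: edges of plaquettes well inside the box `[-R, R]⁴` lie in the box; an edge with a coordinate of
  modulus `≥ R` is at distance `≥ (R+1)/2 - 1` from a plaquette well inside, so `ω_p ≤ 8C₁/(1+R)³` there; the box
  has `≤ 64(1+R)⁴` edges and the fattened box `≤ 1296(1+R)⁴` plaquettes.

HONEST LABEL: route SteinGapBootstrap closes the RECORD rung R2ξ-G (`WeakCouplingRates.XiPow`) conditionally on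
U; nothing here bears on the Yang–Mills mass gap itself.
-/

open Finset
open Literature.MathematicalPhysics.QuantumFieldTheory hiding ZdEdge
open Literature.MathematicalPhysics.QuantumLattice Literature.Probability.LatticeModels

namespace Summit.QuantumFields.YangMills.Theorems.SteinGapBootstrap.BlockGreen

variable {d : ℕ}

/-! ### Decay of the Green one-form on `ℤ⁴` -/

/-- **Green differences on `ℤ⁴`**: `|G₀(z + eᵢ) - G₀(z)| ≤ C₂ / (1 + |z|)³` for all `z`, `G₀ = latticeGreen / 2`
(`z ≠ 0`: Lawler's gradient bound `latticeGreen_gradient_bound`, `|z| ≥ 1`; `z = 0`: `0 < G ≤ G(0) ≤ 1/2`). -/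
theorem exists_half_latticeGreen_diff_le :
    ∃ C₂ : ℝ, 0 ≤ C₂ ∧ ∀ (z : Site 4) (i : Fin 4),
      |latticeGreen (z + Pi.single i 1) / 2 - latticeGreen z / 2| ≤
        C₂ / (1 + Real.sqrt (∑ j, ((z j : ℤ) : ℝ) ^ 2)) ^ 3 := by
  obtain ⟨K', hK'0, hK'⟩ := latticeGreen_gradient_bound (d := 4) (by norm_num)
  refine ⟨1 / 4 + 4 * K', by positivity, fun z i => ?_⟩
  have hsq0 : 0 ≤ Real.sqrt (∑ j, ((z j : ℤ) : ℝ) ^ 2) := Real.sqrt_nonneg _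
  by_cases hz : z = 0
  · subst hz
    have hs : Real.sqrt (∑ j, (((0 : Site 4) j : ℤ) : ℝ) ^ 2) = 0 := by simp
    rw [hs, add_zero, one_pow, div_one]
    have h0 : 0 < latticeGreen (0 : Site 4) := latticeGreen_pos 4 (by norm_num) 0
    have h1 : latticeGreen (0 : Site 4) ≤ 1 / 2 := by
      have := latticeGreen_zero_le_inv_sub_two (d := 4) (by norm_num)
      norm_num at this
      exact this
    have h2 : 0 < latticeGreen ((0 : Site 4) + Pi.single i 1) := latticeGreen_pos 4 (by norm_num) _
    have h3 : latticeGreen ((0 : Site 4) + Pi.single i 1) ≤ latticeGreen 0 :=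
      latticeGreen_le_latticeGreen_zero (by norm_num) _
    rw [abs_le]
    constructor <;> nlinarith
  · have h := hK' z hz i
    set r : ℝ := Real.sqrt (∑ j, ((z j : ℤ) : ℝ) ^ 2) with hr
    have hr1 : 1 ≤ r := one_le_sqrt_sum_sq_of_ne_zero hz
    have hr0 : 0 < r := by linarith
    have hexp : (1 - ((4 : ℕ) : ℝ)) = -((3 : ℕ) : ℝ) := by norm_num
    rw [hexp, Real.rpow_neg hr0.le, Real.rpow_natCast] at h
    -- `h : |G(z+eᵢ) - G(z)| ≤ K' * (r ^ 3)⁻¹`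
    have h8 : (r ^ 3)⁻¹ ≤ 8 / (1 + r) ^ 3 := by
      rw [inv_eq_one_div, div_le_div_iff₀ (by positivity) (by positivity)]
      have : 1 + r ≤ 2 * r := by linarith
      calc 1 * (1 + r) ^ 3 = (1 + r) ^ 3 := one_mul _
        _ ≤ (2 * r) ^ 3 := by gcongr
        _ = 8 * r ^ 3 := by ring
    have hK : |latticeGreen (z + Pi.single i 1) - latticeGreen z| ≤ K' * (8 / (1 + r) ^ 3) :=
      h.trans (mul_le_mul_of_nonneg_left h8 hK'0)
    have hhalf : |latticeGreen (z + Pi.single i 1) / 2 - latticeGreen z / 2| =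
        |latticeGreen (z + Pi.single i 1) - latticeGreen z| / 2 := by
      rw [← sub_div, abs_div, abs_two]
    rw [hhalf, div_le_iff₀ (by norm_num : (0:ℝ) < 2)]
    have hpos : 0 < (1 + r) ^ 3 := by positivity
    calc |latticeGreen (z + Pi.single i 1) - latticeGreen z| ≤ K' * (8 / (1 + r) ^ 3) := hK
      _ = (4 * K') / (1 + r) ^ 3 * 2 := by ring
      _ ≤ (1 / 4 + 4 * K') / (1 + r) ^ 3 * 2 := by gcongr; linarith

/-- **Decay of the Green one-form on `ℤ⁴`**: `|ω_p(y, k)| ≤ C₁ / (1 + |x_p - y|)³` for every plaquette `p` and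
every edge `(y, k)` (`ω_p(·, k)` is a first difference of `G₀(x_p - ·)` or zero). -/
theorem exists_greenForm_le :
    ∃ C₁ : ℝ, 0 ≤ C₁ ∧ ∀ (p : ZdPlaquette 4) (y : Site 4) (k : Fin 4),
      |∑ a : Fin 4, plaquetteBoundarySign a * edgeGreen (plaquetteBoundary p a) (y, k)| ≤
        C₁ / (1 + Real.sqrt (∑ j, (((p.1 - y) j : ℤ) : ℝ) ^ 2)) ^ 3 := by
  obtain ⟨C₂, hC₂0, hC₂⟩ := exists_half_latticeGreen_diff_le
  refine ⟨2 * C₂, by positivity, fun p y k => ?_⟩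
  obtain ⟨x, ⟨⟨i, j⟩, hij⟩⟩ := p
  dsimp only
  have hi := hC₂ (x - y) i
  have hj := hC₂ (x - y) j
  set r : ℝ := Real.sqrt (∑ l, (((x - y) l : ℤ) : ℝ) ^ 2) with hr
  have hB0 : 0 ≤ C₂ / (1 + r) ^ 3 := by positivity
  have e1 : x + Pi.single i 1 - y = x - y + Pi.single i 1 := add_sub_right_comm x _ y
  have e2 : x + Pi.single j 1 - y = x - y + Pi.single j 1 := add_sub_right_comm x _ y
  simp only [Fin.sum_univ_four, plaquetteBoundarySign, plaquetteBoundary, edgeGreen_apply,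
    Matrix.cons_val_zero, Matrix.cons_val_one, Matrix.cons_val_two, Matrix.cons_val_three,
    Matrix.tail_cons, Matrix.head_cons, e1, e2, one_mul, neg_one_mul, mul_ite, mul_zero]
  have h2B : 2 * C₂ / (1 + r) ^ 3 = 2 * (C₂ / (1 + r) ^ 3) := by ring
  rw [h2B, abs_le]
  obtain ⟨hi1, hi2⟩ := abs_le.1 hi
  obtain ⟨hj1, hj2⟩ := abs_le.1 hj
  by_cases hik : i = k <;> by_cases hjk : j = k <;> simp only [hik, hjk, if_true, if_false] <;>
    constructor <;> linarith

/-! ### Lattice geometry of the box truncation -/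

/-- The base point of a boundary edge of `q` differs from the base point of `q` by `0` or `1` in each
coordinate. -/
theorem plaquetteBoundary_fst_apply (q : ZdPlaquette d) (b : Fin 4) (m : Fin d) :
    (plaquetteBoundary q b).1 m = q.1 m ∨ (plaquetteBoundary q b).1 m = q.1 m + 1 := by
  fin_cases b <;> simp [plaquetteBoundary, Pi.single_apply] <;> tauto

/-- Plaquettes well inside the box have all their edges in the box. -/
theorem abs_plaquetteBoundary_le_of_inner (q : ZdPlaquette d) (R : ℕ)
    (hq : ∀ k, 2 * |q.1 k| + 2 ≤ (R : ℤ)) (b : Fin 4) (k : Fin d) :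
    |(plaquetteBoundary q b).1 k| ≤ (R : ℤ) := by
  have h := hq k
  have habs := abs_nonneg (q.1 k)
  rcases plaquetteBoundary_fst_apply q b k with h1 | h1 <;> rw [h1]
  · linarith
  · calc |q.1 k + 1| ≤ |q.1 k| + |1| := abs_add_le _ _
      _ ≤ (R : ℤ) := by rw [abs_one]; linarith

/-- **Far edges.** If `p` is well inside the box of radius `R` and the edge `e` has a coordinate of modulus
`≥ R`, then `1 + R ≤ 2 (1 + |x_p - x_e|)`. -/
theorem one_add_le_two_mul_of_far (p : ZdPlaquette 4) (R : ℕ) (hp : ∀ k, 2 * |p.1 k| + 2 ≤ (R : ℤ))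
    (e : ZdEdge 4) (m : Fin 4) (hm : (R : ℤ) ≤ |e.1 m|) :
    1 + (R : ℝ) ≤ 2 * (1 + Real.sqrt (∑ j, (((p.1 - e.1) j : ℤ) : ℝ) ^ 2)) := by
  have hZ : (R : ℤ) + 2 ≤ 2 * |(p.1 - e.1) m| := by
    have h1 := hp m
    have h2 : |e.1 m| - |p.1 m| ≤ |p.1 m - e.1 m| := by
      rw [abs_sub_comm]; exact abs_sub_abs_le_abs_sub _ _
    rw [Pi.sub_apply]
    linarith
  have hR : (R : ℝ) + 2 ≤ 2 * |(((p.1 - e.1) m : ℤ) : ℝ)| := by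
    have : ((R : ℤ) : ℝ) + 2 ≤ 2 * |(((p.1 - e.1) m : ℤ) : ℝ)| := by
      rw [← Int.cast_abs]; exact_mod_cast hZ
    simpa using this
  have hsq : |(((p.1 - e.1) m : ℤ) : ℝ)| ≤ Real.sqrt (∑ j, (((p.1 - e.1) j : ℤ) : ℝ) ^ 2) :=
    abs_cast_apply_le_sqrt (p.1 - e.1) m
  linarith

/-- Consequence for the Green one-form bound: on far edges `C₁/(1+|x_p - y|)³ ≤ 8C₁/(1+R)³`. -/
theorem div_cube_le_of_far {C₁ : ℝ} (hC₁ : 0 ≤ C₁) (p : ZdPlaquette 4) (R : ℕ)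
    (hp : ∀ k, 2 * |p.1 k| + 2 ≤ (R : ℤ)) (e : ZdEdge 4) (m : Fin 4) (hm : (R : ℤ) ≤ |e.1 m|) :
    C₁ / (1 + Real.sqrt (∑ j, (((p.1 - e.1) j : ℤ) : ℝ) ^ 2)) ^ 3 ≤ 8 * C₁ / (1 + (R : ℝ)) ^ 3 := by
  have h := one_add_le_two_mul_of_far p R hp e m hm
  have hr0 : 0 ≤ Real.sqrt (∑ j, (((p.1 - e.1) j : ℤ) : ℝ) ^ 2) := Real.sqrt_nonneg _
  have hR0 : (0 : ℝ) ≤ R := Nat.cast_nonneg R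
  rw [div_le_div_iff₀ (by positivity) (by positivity)]
  calc C₁ * (1 + (R : ℝ)) ^ 3 ≤ C₁ * (2 * (1 + Real.sqrt (∑ j, (((p.1 - e.1) j : ℤ) : ℝ) ^ 2))) ^ 3 := by
        gcongr
    _ = 8 * C₁ * (1 + Real.sqrt (∑ j, (((p.1 - e.1) j : ℤ) : ℝ) ^ 2)) ^ 3 := by ring

/-- The finite set of (positively oriented) edges of `ℤ⁴` with base point in the box `[-R, R]⁴`. -/
theorem mem_boxEdges_iff (R : ℕ) (e : ZdEdge 4) :
    e ∈ (Fintype.piFinset fun _ : Fin 4 => Finset.Icc (-(R : ℤ)) R) ×ˢ (Finset.univ : Finset (Fin 4)) ↔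
      ∀ k : Fin 4, |e.1 k| ≤ (R : ℤ) := by
  simp only [Finset.mem_product, Fintype.mem_piFinset, Finset.mem_Icc, Finset.mem_univ, and_true, abs_le]

/-- The box contains `4 (2R+1)⁴ ≤ 64 (1+R)⁴` edges. -/
theorem card_boxEdges_le (R : ℕ) :
    (((Fintype.piFinset fun _ : Fin 4 => Finset.Icc (-(R : ℤ)) R) ×ˢ (Finset.univ : Finset (Fin 4))).card : ℝ)
      ≤ 64 * (1 + (R : ℝ)) ^ 4 := by
  rw [Finset.card_product, Fintype.card_piFinset, Finset.prod_const, Finset.card_univ, Fintype.card_fin,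
    Int.card_Icc]
  have h : ((R : ℤ) + 1 - -(R : ℤ)).toNat = 2 * R + 1 := by
    have : (R : ℤ) + 1 - -(R : ℤ) = ((2 * R + 1 : ℕ) : ℤ) := by push_cast; ring
    rw [this, Int.toNat_natCast]
  rw [h]
  push_cast
  have hR : (0 : ℝ) ≤ R := Nat.cast_nonneg R
  have h4 : (2 * (R : ℝ) + 1) ^ 4 ≤ (2 * (1 + (R : ℝ))) ^ 4 := by gcongr; linarith
  nlinarith [h4]

/-- The big box of plaquette base points `[-(R+1), R+1]⁴ × (planes)` has at most `1296 (1+R)⁴` elements. -/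
theorem card_bigBoxPlaquettes_le (R : ℕ) :
    (((Fintype.piFinset fun _ : Fin 4 => Finset.Icc (-((R : ℤ) + 1)) ((R : ℤ) + 1)) ×ˢ
        (Finset.univ : Finset {ij : Fin 4 × Fin 4 // ij.1 < ij.2})).card : ℝ) ≤ 1296 * (1 + (R : ℝ)) ^ 4 := by
  rw [Finset.card_product, Fintype.card_piFinset, Finset.prod_const, Finset.card_univ, Fintype.card_fin,
    Finset.card_univ, Int.card_Icc]
  have h : ((R : ℤ) + 1 + 1 - -((R : ℤ) + 1)).toNat = 2 * R + 3 := by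
    have : (R : ℤ) + 1 + 1 - -((R : ℤ) + 1) = ((2 * R + 3 : ℕ) : ℤ) := by push_cast; ring
    rw [this, Int.toNat_natCast]
  rw [h]
  have hsub : Fintype.card {ij : Fin 4 × Fin 4 // ij.1 < ij.2} ≤ 16 :=
    (Fintype.card_subtype_le _).trans (by simp)
  have hR : (0 : ℝ) ≤ R := Nat.cast_nonneg R
  have h1 : (2 * (R : ℝ) + 3) ^ 4 ≤ 81 * (1 + (R : ℝ)) ^ 4 := by
    have h4 : (2 * (R : ℝ) + 3) ^ 4 ≤ (3 * (1 + (R : ℝ))) ^ 4 := by gcongr; linarith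
    nlinarith [h4]
  have h2 : ((Fintype.card {ij : Fin 4 × Fin 4 // ij.1 < ij.2} : ℕ) : ℝ) ≤ 16 := by exact_mod_cast hsub
  push_cast
  calc (2 * (R : ℝ) + 3) ^ 4 * (Fintype.card {ij : Fin 4 × Fin 4 // ij.1 < ij.2} : ℝ)
      ≤ (81 * (1 + (R : ℝ)) ^ 4) * 16 := mul_le_mul h1 h2 (by positivity) (by positivity)
    _ = 1296 * (1 + (R : ℝ)) ^ 4 := by ring

end Summit.QuantumFields.YangMills.Theorems.SteinGapBootstrap.BlockGreen
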